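import Mathlib
import HarnessLib
import Summits.NavierStokesRegularity.NavierStokesRegularity.Theorems.PoloidalWindowDoorLrcModEntireRidgeWebClass
import Summits.NavierStokesRegularity.NavierStokesRegularity.Theorems.PoloidalWindowDoorLrcModEntireTwistingTHSlopeSlab

/-!
# Item `LrcModEntire` (stmt-NavierStokesRegularity-20428) — THE (Q4) ENTRANCE WITH THE (TH) STRUCTURE OF THE HULL ELEMENT: one theorem from the class package, the global
# (TH) identity, the frozen law, a non-flat witness and a complete non-degenerate hot branch

ns-k2-port-2 g6 (helper prover under the LEAD of item 20428, ns-poloidal-K2-p3 g15; `--supports stmt-NavierStokesRegularity-20428 --as helper`).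
Composition of `…RidgeWebClass.exists_hullLimit_ridgeWeb` (p714382) with `…RidgeHullTH` (TH / frozen law hull-closed) and `…TwistingTHSlopeSlab` (slope function on a uniform
slab, the same `μ` for the hull limit): memo `Cruxes/LrcModEntire/ENTRANCE-Q4-port2g6.md` (c)+(d) in ONE statement.  With the LEAD's BRANCH-PARAM (`…RidgeGlobalBranchT2b`,
landing) supplying the branch from the `stub_T2b` binders + a non-degenerate hot point, this is the (Q4) object of ENTRANCE-Q4 §2 by name.

* `exists_hullLimit_ridgeWebTH` — inputs: pinned peakless class package (VERBATIM), `σ = ±1`, the complete `κ₀`-branch `γ` with normal `ν`, the GLOBAL bilinear (TH) identity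
  (`stub_T2b` binder 3 VERBATIM), the frozen law (`stub_T2b` clause VERBATIM), a non-flat witness `∂_{c₁}v₂(−1,y₁) ≠ 0`, `y₁ ∈ P₀`, and `s_k → +∞`.  Output: everything of
  `exists_hullLimit_ridgeWeb` (hull element `U`, limit branch `Γ`, `ν_Γ`, `F`, `R`, `r`, `δ`, `m`, (Q3∞), cold lateral / hot centre, strict concavity, WEB FERMAT) AND the
  bilinear (TH) identity for `U` at every `t < 0`, the frozen law for `U` at every `s < 0`, a `C³` slope function `μ` with `μ(−1,0)` = the witness ratio and the slope form
  `∂₂w_b = μ(t,x₂)∂_b w₂` on the uniform slab `|t+1| < ρ ≤ 1`, `|x₂| < ρ` for BOTH `w = v` and `w = U` (plus the eventual form for `U` near every point of `P₀`).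

WHAT THIS IS NOT: not a claim about Navier–Stokes regularity — the typed entrance object of the research cell (Q4) «HOMOGENEOUS NULL RIDGE IN A STRICT WAVE LAYER» for hypothetical
blow-up profiles (bears_on LADDER-NS N0, item 20428 / crux 19708; 20428/19708/27893 OPEN; (Q4) OPEN; `stub_T2b` NOT closed).  No summit statement is proved here.
-/

noncomputable section

-- the summit and its single sub-problem share the name (CONVENTIONS §1), as in every Theorems file
set_option linter.dupNamespace false

namespace Summit.NavierStokesRegularity.NavierStokesRegularity.Theorems.PoloidalWindowDoorLrcModEntireRidgeWebTH

open Set Filter Topology Metric Function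
open scoped ContDiff InnerProductSpace RealInnerProductSpace Laplacian
open Literature.Analysis Literature.Analysis.FluidPDE
open Summit.NavierStokesRegularity.NavierStokesRegularity.Theorems.PoloidalWindowDoorLrcModEntireRidgeWebClass
open Summit.NavierStokesRegularity.NavierStokesRegularity.Theorems.PoloidalWindowDoorLrcModEntireRidgeHullTH
open Summit.NavierStokesRegularity.NavierStokesRegularity.Theorems.PoloidalWindowDoorLrcModEntireTwistingTHSlopeSlab

/-- **THE (Q4) ENTRANCE WITH THE (TH) STRUCTURE OF THE HULL ELEMENT.**  See the module docstring. -/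
theorem exists_hullLimit_ridgeWebTH (C : ℝ) (v : ℝ → EuclideanSpace ℝ (Fin 3) → EuclideanSpace ℝ (Fin 3))
    (hP : (Literature.Analysis.FluidPDE.HasTypeITimeDecay C v ∧
        ContinuousOn (Function.uncurry v) (Set.Iio (0 : ℝ) ×ˢ Set.univ) ∧
        (∀ s t : ℝ, s < t → t < 0 → ∀ x, v t x =
          Literature.Analysis.UnboundedOperators.heatExtension (v s) (t - s) x -
            Literature.Analysis.FluidPDE.oseenDuhamel 1 s v v t x) ∧
        (∀ t < 0, Literature.Analysis.FluidPDE.VectorCalculus.IsDivFree (v t)) ∧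
        (∀ s < 0, ∀ q, ⟪Literature.Analysis.FluidPDE.curl (v s) q, EuclideanSpace.single 2 1⟫_ℝ = 0) ∧
        v (-1) 0 2 ≠ 0 ∧ (∀ t < 0, ∀ x, Real.sqrt (-t) * |v t x 2| ≤ |v (-1) 0 2|) ∧
        (∀ h : EuclideanSpace ℝ (Fin 3), fderiv ℝ (v (-1)) 0 h 2 = 0) ∧
        (deriv (fun s => v s 0 2) (-1) = v (-1) 0 2 / 2 ∧ v (-1) 0 2 * (Δ (fun q => v (-1) q 2)) 0 ≤ 0)))
    (hK : (∀ (s z₀ σ M : ℝ) (K O : Set (EuclideanSpace ℝ (Fin 3))), s < 0 →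
        ((σ = 1 ∨ σ = -1) ∧ IsCompact K ∧ K.Nonempty ∧ (∀ q ∈ K, q 2 = z₀ ∧ σ * v s q 2 = M) ∧
          IsOpen O ∧ K ⊆ O ∧ (∀ q ∈ O, q 2 = z₀ → σ * v s q 2 ≤ M) ∧
          (∀ q ∈ O, q 2 = z₀ → σ * v s q 2 = M → q ∈ K)) → False))
    {σ : ℝ} (hσ : σ = 1 ∨ σ = -1)
    {γ : ℝ → EuclideanSpace ℝ (Fin 3)} (hγ2 : ContDiff ℝ 2 γ) (hplane : ∀ s, γ s 2 = 0) (hunit : ∀ s, ‖deriv γ s‖ = 1)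
    (hhot : ∀ s, v (-1) (γ s) 2 = v (-1) 0 2)
    {ν : ℝ → EuclideanSpace ℝ (Fin 3)} (hν : ∀ s, ν s = WithLp.toLp 2 ![-(deriv γ s 1), deriv γ s 0, 0])
    {κ₀ : ℝ} (hκ₀ : 0 < κ₀) (hκ : ∀ s, κ₀ ≤ -(fderiv ℝ (fderiv ℝ (fun y => σ * v (-1) y 2)) (γ s) (ν s) (ν s)))
    (hTH : ∀ t < 0, ∀ x x' : EuclideanSpace ℝ (Fin 3), x 2 = x' 2 → ∀ b c : Fin 3, b ≠ 2 → c ≠ 2 →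
      fderiv ℝ (v t) x (EuclideanSpace.single 2 1) b * fderiv ℝ (v t) x' (EuclideanSpace.single c 1) 2 =
        fderiv ℝ (v t) x' (EuclideanSpace.single 2 1) c * fderiv ℝ (v t) x (EuclideanSpace.single b 1) 2)
    (hfrozen : ∀ s < 0, ∀ y, ⟪fderiv ℝ (v s) y (Literature.Analysis.FluidPDE.curl (v s) y), EuclideanSpace.single 2 1⟫_ℝ = 0)
    {y₁ : EuclideanSpace ℝ (Fin 3)} (hy₁ : y₁ 2 = 0) {c₁ : Fin 3} (hc₁ : c₁ ≠ 2)
    (hne₁ : fderiv ℝ (v (-1)) y₁ (EuclideanSpace.single c₁ 1) 2 ≠ 0)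
    {sq : ℕ → ℝ} (hsq : Tendsto sq atTop atTop) :
    ∃ (φ : ℕ → ℕ) (U : ℝ → EuclideanSpace ℝ (Fin 3) → EuclideanSpace ℝ (Fin 3)) (Γ νΓ : ℝ → EuclideanSpace ℝ (Fin 3))
      (F : ℝ → EuclideanSpace ℝ (Fin 3) → ℝ) (R : ℝ → ℝ → ℝ) (r δ m : ℝ) (μ : ℝ → ℝ → ℝ) (ρ : ℝ), StrictMono φ ∧
      -- the hull limit (pinned, peakless, same hot value), slices converging locally uniformly, re-based branches converging to `Γ`
      (Literature.Analysis.FluidPDE.HasTypeITimeDecay C U ∧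
        ContinuousOn (Function.uncurry U) (Set.Iio (0 : ℝ) ×ˢ Set.univ) ∧
        (∀ s t : ℝ, s < t → t < 0 → ∀ x, U t x =
          Literature.Analysis.UnboundedOperators.heatExtension (U s) (t - s) x -
            Literature.Analysis.FluidPDE.oseenDuhamel 1 s U U t x) ∧
        (∀ t < 0, Literature.Analysis.FluidPDE.VectorCalculus.IsDivFree (U t)) ∧
        (∀ s < 0, ∀ q, ⟪Literature.Analysis.FluidPDE.curl (U s) q, EuclideanSpace.single 2 1⟫_ℝ = 0) ∧
        U (-1) 0 2 ≠ 0 ∧ (∀ t < 0, ∀ x, Real.sqrt (-t) * |U t x 2| ≤ |U (-1) 0 2|) ∧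
        (∀ h : EuclideanSpace ℝ (Fin 3), fderiv ℝ (U (-1)) 0 h 2 = 0) ∧
        (deriv (fun s => U s 0 2) (-1) = U (-1) 0 2 / 2 ∧ U (-1) 0 2 * (Δ (fun q => U (-1) q 2)) 0 ≤ 0)) ∧
      (∀ (s z₀ σ M : ℝ) (K O : Set (EuclideanSpace ℝ (Fin 3))), s < 0 →
        ((σ = 1 ∨ σ = -1) ∧ IsCompact K ∧ K.Nonempty ∧ (∀ q ∈ K, q 2 = z₀ ∧ σ * U s q 2 = M) ∧
          IsOpen O ∧ K ⊆ O ∧ (∀ q ∈ O, q 2 = z₀ → σ * U s q 2 ≤ M) ∧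
          (∀ q ∈ O, q 2 = z₀ → σ * U s q 2 = M → q ∈ K)) → False) ∧
      U (-1) 0 2 = v (-1) 0 2 ∧
      (∀ t < 0, TendstoLocallyUniformly (fun j x => v t (x + γ (sq (φ j)))) (U t) atTop) ∧
      (∀ s, Tendsto (fun j => γ (sq (φ j) + s) - γ (sq (φ j))) atTop (𝓝 (Γ s))) ∧
      -- re-entry package of the limit branch
      (∀ y ∈ {y : EuclideanSpace ℝ (Fin 3) | y 2 = 0 ∧ U (-1) y 2 = U (-1) 0 2}, fderiv ℝ (fun x => U (-1) x 2) y = 0) ∧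
      ContDiff ℝ ∞ Γ ∧ Γ 0 = 0 ∧ (∀ s, Γ s 2 = 0) ∧ (∀ s, ‖deriv Γ s‖ = 1) ∧ (∀ s, U (-1) (Γ s) 2 = U (-1) 0 2) ∧
      (∀ s, νΓ s = WithLp.toLp 2 ![-(deriv Γ s 1), deriv Γ s 0, 0]) ∧
      (∀ s, κ₀ ≤ -(fderiv ℝ (fderiv ℝ (fun y => σ * U (-1) y 2)) (Γ s) (νΓ s) (νΓ s))) ∧
      -- the signed space–time component, the homogeneous ridge height, the tube radius, the window, the level
      (F = fun τ y => σ * U (-1 + τ) y 2) ∧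
      (∀ τ z, R τ z = sSup ((fun n : ℝ => F τ (Γ 0 + n • νΓ 0 + z • EuclideanSpace.single 2 (1 : ℝ))) '' Icc (-r) r)) ∧
      0 < r ∧ 0 < δ ∧ δ ≤ 1 / 4 ∧
      -- (Q3∞): the cross-section maximum is homogeneous along `Γ`
      (∀ τ z : ℝ, |τ| < δ → |z| < δ → ∀ s : ℝ,
        sSup ((fun n : ℝ => F τ (Γ s + n • νΓ s + z • EuclideanSpace.single 2 (1 : ℝ))) '' Icc (-r) r) = R τ z) ∧
      -- cold lateral values, hot centre
      (∀ τ z : ℝ, |τ| < δ → |z| < δ → ∀ s n : ℝ, (n = r ∨ n = -r) → F τ (Γ s + n • νΓ s + z • EuclideanSpace.single 2 (1 : ℝ)) < m) ∧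
      (∀ τ z : ℝ, |τ| < δ → |z| < δ → ∀ s : ℝ, m ≤ F τ (Γ s + z • EuclideanSpace.single 2 (1 : ℝ))) ∧
      -- strict concavity of the cross-sections on the open tube
      (∀ τ z : ℝ, |τ| < δ → |z| < δ → ∀ s : ℝ, ∀ n ∈ Ioo (-r) r,
        fderiv ℝ (fderiv ℝ (F τ)) (Γ s + n • νΓ s + z • EuclideanSpace.single 2 (1 : ℝ)) (νΓ s) (νΓ s) < 0) ∧
      -- THE WEB FERMAT LAW at every cross-section
      (∀ τ₀ z₀ : ℝ, |τ₀| < δ → |z₀| < δ → ∀ s₀ : ℝ, ∃ n₀ ∈ Ioo (-r) r,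
        F τ₀ (Γ s₀ + n₀ • νΓ s₀ + z₀ • EuclideanSpace.single 2 (1 : ℝ)) = R τ₀ z₀ ∧
        (∀ n ∈ Icc (-r) r, n ≠ n₀ → F τ₀ (Γ s₀ + n • νΓ s₀ + z₀ • EuclideanSpace.single 2 (1 : ℝ)) < R τ₀ z₀) ∧
        DifferentiableAt ℝ (uncurry R) (τ₀, z₀) ∧
        fderiv ℝ (uncurry F) (τ₀, Γ s₀ + n₀ • νΓ s₀ + z₀ • EuclideanSpace.single 2 (1 : ℝ)) =
          (fderiv ℝ (uncurry R) (τ₀, z₀)).comp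
            ((ContinuousLinearMap.fst ℝ ℝ (EuclideanSpace ℝ (Fin 3))).prod
              ((EuclideanSpace.proj (2 : Fin 3)).comp (ContinuousLinearMap.snd ℝ ℝ (EuclideanSpace ℝ (Fin 3)))))) ∧
      -- (TH) STRUCTURE OF THE HULL ELEMENT: the global bilinear identity, the frozen law, and the slope function of `v` on a uniform slab — the SAME `μ` for `U`
      (∀ t < 0, ∀ x x' : EuclideanSpace ℝ (Fin 3), x 2 = x' 2 → ∀ b c : Fin 3, b ≠ 2 → c ≠ 2 →
        fderiv ℝ (U t) x (EuclideanSpace.single 2 1) b * fderiv ℝ (U t) x' (EuclideanSpace.single c 1) 2 =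
          fderiv ℝ (U t) x' (EuclideanSpace.single 2 1) c * fderiv ℝ (U t) x (EuclideanSpace.single b 1) 2) ∧
      (∀ s < 0, ∀ y, ⟪fderiv ℝ (U s) y (Literature.Analysis.FluidPDE.curl (U s) y), EuclideanSpace.single 2 1⟫_ℝ = 0) ∧
      0 < ρ ∧ ρ ≤ 1 ∧ ContDiff ℝ 3 (uncurry μ) ∧
      μ (-1) 0 = fderiv ℝ (v (-1)) y₁ (EuclideanSpace.single 2 1) c₁ / fderiv ℝ (v (-1)) y₁ (EuclideanSpace.single c₁ 1) 2 ∧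
      (∀ t : ℝ, |t + 1| < ρ → ∀ x : EuclideanSpace ℝ (Fin 3), |x 2| < ρ → ∀ b : Fin 3, b ≠ 2 →
        fderiv ℝ (v t) x (EuclideanSpace.single 2 1) b = μ t (x 2) * fderiv ℝ (v t) x (EuclideanSpace.single b 1) 2) ∧
      (∀ t : ℝ, |t + 1| < ρ → ∀ x : EuclideanSpace ℝ (Fin 3), |x 2| < ρ → ∀ b : Fin 3, b ≠ 2 →
        fderiv ℝ (U t) x (EuclideanSpace.single 2 1) b = μ t (x 2) * fderiv ℝ (U t) x (EuclideanSpace.single b 1) 2) ∧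
      (∀ t₀ : ℝ, |t₀ + 1| < ρ → ∀ y₀ : EuclideanSpace ℝ (Fin 3), y₀ 2 = 0 →
        ∀ᶠ z in 𝓝 ((t₀, y₀) : ℝ × EuclideanSpace ℝ (Fin 3)), ∀ b : Fin 3, b ≠ 2 →
          fderiv ℝ (U z.1) z.2 (EuclideanSpace.single 2 1) b = μ z.1 (z.2 2) * fderiv ℝ (U z.1) z.2 (EuclideanSpace.single b 1) 2) := by
  have hP' := hP
  obtain ⟨hrate, hcont, hmild, hdivf, -, -, -, -, -⟩ := hP'
  obtain ⟨φ, U, Γ, νΓ, F, R, r, δ, m, hφ, hPU, hKU, hUN, hconv, hptγ, hcritU, hΓs, hΓ0, hΓplane, hΓunit, hΓhot, hνΓ, hκU, hF, hR,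
    hr, hδ, hδ14, hhom, hlat, hmid, hconc, hweb⟩ :=
    exists_hullLimit_ridgeWeb C v hP hK hσ hγ2 hplane hunit hhot hν hκ₀ hκ hsq
  -- the translation points lie in the thread plane
  have hy0 : ∀ j, γ (sq (φ j)) 2 = 0 := fun j => hplane _
  -- (TH) and the frozen law pass to the hull limit
  have hTHU : ∀ t < 0, ∀ x x' : EuclideanSpace ℝ (Fin 3), x 2 = x' 2 → ∀ b c : Fin 3, b ≠ 2 → c ≠ 2 →
      fderiv ℝ (U t) x (EuclideanSpace.single 2 1) b * fderiv ℝ (U t) x' (EuclideanSpace.single c 1) 2 =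
        fderiv ℝ (U t) x' (EuclideanSpace.single 2 1) c * fderiv ℝ (U t) x (EuclideanSpace.single b 1) 2 := fun t ht =>
    TH_of_hullLimit hrate hcont hmild hdivf ht (hTH t ht) (hconv t ht)
  have hfrozenU : ∀ s < 0, ∀ y, ⟪fderiv ℝ (U s) y (curl (U s) y), EuclideanSpace.single 2 1⟫_ℝ = 0 := fun s hs =>
    frozenLaw_of_hullLimit hrate hcont hmild hdivf hs (hfrozen s hs) (hconv s hs)
  -- the slope function of `v` on a uniform slab, the same for `U`
  obtain ⟨μ, ρ, hρ, hμ3, hslab, -, hμ0⟩ := exists_slopeFunction_slab hrate hcont hmild hTH hy₁ hc₁ hne₁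
  set ρ' : ℝ := min ρ 1 with hρ'
  have hρ'0 : 0 < ρ' := lt_min hρ one_pos
  have hρ'1 : ρ' ≤ 1 := min_le_right _ _
  have hρ'ρ : ρ' ≤ ρ := min_le_left _ _
  have hslab' : ∀ t : ℝ, |t + 1| < ρ' → ∀ x : EuclideanSpace ℝ (Fin 3), |x 2| < ρ' → ∀ b : Fin 3, b ≠ 2 →
      fderiv ℝ (v t) x (EuclideanSpace.single 2 1) b = μ t (x 2) * fderiv ℝ (v t) x (EuclideanSpace.single b 1) 2 :=
    fun t ht x hx b hb => hslab t (lt_of_lt_of_le ht hρ'ρ) x (lt_of_lt_of_le hx hρ'ρ) b hb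
  obtain ⟨hslabU, hevU⟩ := slopeForm_hullLimit_slab hrate hcont hmild hdivf hρ'1 hslab' hy0 hconv
  exact ⟨φ, U, Γ, νΓ, F, R, r, δ, m, μ, ρ', hφ, hPU, hKU, hUN, hconv, hptγ, hcritU, hΓs, hΓ0, hΓplane, hΓunit, hΓhot, hνΓ, hκU, hF, hR,
    hr, hδ, hδ14, hhom, hlat, hmid, hconc, hweb, hTHU, hfrozenU, hρ'0, hρ'1, hμ3, hμ0, hslab', hslabU, hevU⟩

end Summit.NavierStokesRegularity.NavierStokesRegularity.Theorems.PoloidalWindowDoorLrcModEntireRidgeWebTH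

end
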